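import Literature.NumberTheory.EllipticCurves.PAdicLFunctionMinus
import Literature.NumberTheory.EllipticCurves.PAdicLFunctionIntegralityProofs
import Literature.NumberTheory.EllipticCurves.ModularSymbolsNormalizedSymbolProofs
import HarnessLib

/-!
# Half-integrality of the minus modular symbol: `2·[r]⁻_f ∈ ℤ` at cusps of `2`-power (or
# `N`-prime) denominator, and the bound `‖μ⁻_{f,α}‖₂ ≤ 2` (proofs only)

A *proofs* file (theorems only: no definition, no named fact; D-0014/D-0026), the MINUS companion of
`PAdicLFunctionIntegralityProofs` (`norm_ratPlusSymbol_le_one`, odd `p`) and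
`PAdicLFunctionIntegralityAtTwoProofs` (`norm_ratPlusSymbol_two_le_two`), for the objects of
`PAdicLFunctionMinus` (`ratMinusSymbol f r = [r]⁻_f`, `msdMinusMeasure f α` = `μ⁻_{f,α}` of
Mazur–Tate–Teitelbaum 1986 §I.8, §I.10 in the tree's normalisation `im Λ_f = ℤ · Ω⁻_f/2`).

THE POINT. For the PLUS symbol the cusp `r₀ = 0` (or `1/2`) to which a cusp `a/pⁿ` is
`Γ₀(N)`-equivalent carries the non-period `{∞, r₀}_f = L(f,1)`-type value, whence the Eisenstein
multiple `(a_ℓ − ℓ − 1)` in `norm_ratPlusSymbol_le_one`. For the MINUS symbol there is no such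
offset: `{∞, −0} = {∞, 0}` and `{∞, −1/2} = {∞, 1/2 − 1} = {∞, 1/2}`, so `im {∞, 0}_f = im {∞, 1/2}_f = 0`
for real-coefficient `f` (`im_modularSymbol_zero`, `im_modularSymbol_half`), and therefore, with
`im Λ_f = ℤ · Ω⁻_f/2` (definition of `minusPeriod`):

* §1–§3 (`exists_ratMinusSymbol_eq_div_two_of_sub_mem`, `…_of_coprime`, `…_eq_div_two`,
  `exists_two_mul_ratMinusSymbol_eq_intCast`): **`2·[r]⁻_f ∈ ℤ`** for every cusp `r` with
  `gcd(den r, N) = 1`, and — when `4 ∤ N` — for every cusp `r = a/2ⁿ`; NO Eisenstein/irreducibility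
  hypothesis and no newform hypothesis (real coefficients suffice; in the degenerate case `Ω⁻_f = 0`
  all symbols are `0`). The case `2 ∥ N` uses §2.
* §2 (`modularSymbol_div_sub_inv_mem_periodLattice`, `modularSymbol_div_sub_half_mem_periodLattice`):
  the cusp-class lemma — for `N = qM` and a cusp `a/c` in lowest terms with `q ∣ c`, `gcd(c, M) = 1`,
  `{∞, a/c}_f − {∞, 1/q}_f ∈ Λ_f` (the cusps `a/c` and `1/q` are `Γ₀(N)`-equivalent: Cremona 1997,
  Lemma 2.2.3 (3) with `gcd(q·c, N) = q`; Manin 1972, Prop. 1.4, Thm. 1.6), by an explicit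
  `γ = (a − qB, B; c − qD, D) ∈ Γ₀(N)` with `γ(1/q) = a/c` (Chinese remainder for `D`).
* §4 (`norm_ratMinusSymbol_two_le_two`, `norm_ratMinusSymbol_le_one`,
  `norm_msdMinusMeasure_two_le_two`, `norm_msdMinusMeasure_le_one`): hence `‖[r]⁻_f‖₂ ≤ 2` and
  `‖μ⁻_{f,α}(a + 2ᵐℤ₂)‖ ≤ 2` for `4 ∤ N` and `‖α⁻¹‖ ≤ 1`; and at an ODD prime `p ∤ N`,
  `‖[a/pᵐ]⁻_f‖_p ≤ 1`, `‖μ⁻_{f,α}(a + pᵐℤ_p)‖ ≤ 1` (the boundedness of `μ⁻` named as missing in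
  the docstring of `PAdicLFunctionMinus`).
* §5 (`minusSymbol_neg`, `ratMinusSymbol_neg`, `msdMinusMeasure_neg`): the minus symbol and the
  minus measure are ODD, `[−r]⁻ = −[r]⁻`, `μ⁻(−a + pᵐℤ_p) = −μ⁻(a + pᵐℤ_p)`.

STATUS IN PRINT. The ingredients are Manin's cusp relation / `Γ₀(N)`-equivalence of cusps
(Manin 1972, Prop. 1.4, Thm. 1.6; Cremona 1997, §2.2, Lemma 2.2.3) and the period conventions of
Cremona §2.8 / Mazur–Tate–Teitelbaum §I.8; the statement "`2[a/2ⁿ]⁻_f ∈ ℤ` for `4 ∤ N`" in THIS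
normalisation is a theorem of the tree's definitions, not printed as such. Requested by the residual
cell `b2b-bsdres` (class O1 = X5 at `p = 2`; o1 lens-1 GEN 3, step S1 "`two_mul_ratMinusSymbol_mem_int`",
`HOME/cells/o1/ROUTES-O1.md`). EVIDENCE before this proof (census, not used): `2[a/2ⁿ]⁻ ∈ ℤ` on
648/648 optimal `f` with `N ≤ 500`, `4 ∤ N` (kit job j123633).

## References

* Ju. I. Manin, *Parabolic points and zeta functions of modular curves*, Izv. Akad. Nauk SSSR 36
  (1972), Prop. 1.4, Thm. 1.6. [Manin1972]
* J. E. Cremona, *Algorithms for modular elliptic curves*, 2nd ed. (1997), §2.2 Lemma 2.2.3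
  (cusp equivalence under `Γ₀(N)`), §2.8 (`Ω^±`). [CremonaAlgorithms1997]
* B. Mazur, J. Tate, J. Teitelbaum, *On `p`-adic analogues of the conjectures of Birch and
  Swinnerton-Dyer*, Invent. Math. 84 (1986), §I.8 (`[a/m]^±`), §I.10 (10.1).
  [MazurTateTeitelbaum1986Invent]
-/

noncomputable section

open scoped MatrixGroups ModularForm

open CongruenceSubgroup Filter Topology Literature.NumberTheory.EllipticCurves.ModularForms

namespace Literature.NumberTheory.EllipticCurves.ModularForms

/-! ### §1. `im {∞, 0}_f = im {∞, 1/2}_f = 0` and imaginary parts modulo `im Λ_f` -/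

section Symbols

variable {N : ℕ} [NeZero N] (f : CuspForm (Gamma0 N) 2)

/-- `{∞, −1/2}_f = {∞, 1/2}_f`, since `−1/2 = 1/2 − 1` (`modularSymbol_add_intCast_holds`;
Manin 1972, §1.2). [cite: Manin1972, §1.2] -/
theorem modularSymbol_neg_half : modularSymbol f (-(1 / 2 : ℚ)) = modularSymbol f (1 / 2) := by
  have h := modularSymbol_add_intCast_holds f (1 / 2 : ℚ) (-1)
  rwa [show (1 / 2 : ℚ) + ((-1 : ℤ) : ℚ) = -(1 / 2) by norm_num] at h

/-- `minusSymbol f (1/2) = ({∞, 1/2} − {∞, −1/2})/2 = 0`. [cite: MazurTateTeitelbaum1986Invent, §I.8] -/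
theorem minusSymbol_half : minusSymbol f (1 / 2) = 0 := by
  rw [minusSymbol, modularSymbol_neg_half, sub_self, zero_div]

/-- For real-coefficient `f`: if `minusSymbol f r = 0` then `im {∞, r}_f = 0`
(`minusSymbol f r = i · im {∞, r}_f`, Cremona §2.8). [cite: CremonaAlgorithms1997, §2.8] -/
theorem im_modularSymbol_eq_zero_of_minusSymbol_eq_zero (hreal : ∀ n, (cuspCoeff f n).im = 0)
    {r : ℚ} (h : minusSymbol f r = 0) : (modularSymbol f r).im = 0 := by
  have h1 := minusSymbol_eq_im_mul_I_holds f hreal r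
  rw [h] at h1
  have h2 := congrArg Complex.im h1
  simp only [Complex.zero_im, Complex.mul_im, Complex.ofReal_re, Complex.ofReal_im, Complex.I_re,
    Complex.I_im, mul_zero, mul_one, add_zero] at h2
  exact h2.symm

/-- `im {∞, 0}_f = 0` for real-coefficient `f`. [cite: CremonaAlgorithms1997, §2.8] -/
theorem im_modularSymbol_zero (hreal : ∀ n, (cuspCoeff f n).im = 0) :
    (modularSymbol f 0).im = 0 :=
  im_modularSymbol_eq_zero_of_minusSymbol_eq_zero f hreal (minusSymbol_zero f)

/-- `im {∞, 1/2}_f = 0` for real-coefficient `f`. [cite: CremonaAlgorithms1997, §2.8] -/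
theorem im_modularSymbol_half (hreal : ∀ n, (cuspCoeff f n).im = 0) :
    (modularSymbol f (1 / 2)).im = 0 :=
  im_modularSymbol_eq_zero_of_minusSymbol_eq_zero f hreal (minusSymbol_half f)

omit [NeZero N] in
/-- If `z − w ∈ Λ_f`, `im w = 0` and `im Λ_f = ℤ · (Ω/2)` then `im z = k Ω/2` for some `k ∈ ℤ`
(twin of `exists_re_eq_add_of_sub_mem`; the bookkeeping of Cremona §2.8, `im Λ_f = ℤ y`).
[cite: CremonaAlgorithms1997, §2.8] -/
theorem exists_im_eq_of_sub_mem {Ω : ℝ} (hΩ : imagPeriods f = AddSubgroup.zmultiples (Ω / 2))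
    {z w : ℂ} (h : z - w ∈ periodLattice f) (hw : w.im = 0) :
    ∃ k : ℤ, z.im = k * (Ω / 2) := by
  have him : (z - w).im ∈ imagPeriods f := AddSubgroup.mem_map_of_mem _ h
  rw [hΩ, AddSubgroup.mem_zmultiples_iff] at him
  obtain ⟨k, hk⟩ := him
  refine ⟨k, ?_⟩
  rw [Complex.sub_im, hw, sub_zero, zsmul_eq_mul] at hk
  exact hk.symm

/-! ### §2. The cusp class of `1/q` for `N = qM`: `{∞, a/c} − {∞, 1/q} ∈ Λ_f` -/

/-- **Cusps `a/c` with `q ∣ c`, `gcd(c, N/q) = 1` are `Γ₀(N)`-equivalent to `1/q`** (`N = qM`):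
for `a/c` in lowest terms (`IsCoprime a c`), `c = qc' ≠ 0`, `gcd(c, M) = 1`,
`{∞, a/c}_f − {∞, 1/q}_f ∈ Λ_f`. With `D ≡ a⁻¹ (mod c)`, `D ≡ c' (mod M)` (Chinese remainder,
`gcd(c, M) = 1`), `B = (aD − 1)/c`, the matrix `γ = (a − qB, B; c − qD, D)` has determinant
`aD − Bc = 1`, lower-left entry `c − qD = q(c' − D) ≡ 0 (mod qM)`, and `γ(1/q) = (a/q)/(c/q) = a/c`;
Manin's relation `{∞, γ(1/q)} = {∞, γ∞} + {∞, 1/q}` (`modularSymbol_gamma0_smul_holds`) exhibits the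
difference as the period `{∞, γ∞}_f`. This is Cremona's criterion, Lemma 2.2.3 (3), in the case
`gcd(q₁q₂, N) = q` (both sides `≡ 0`). [cite: CremonaAlgorithms1997, §2.2 Lemma 2.2.3]
[cite: Manin1972, Prop. 1.4 and Thm. 1.6] -/
theorem modularSymbol_div_sub_inv_mem_periodLattice {q M a c c' : ℤ} (hN : (N : ℤ) = q * M)
    (hc : c = q * c') (hc0 : c ≠ 0) (hac : IsCoprime a c) (hcM : IsCoprime c M) :
    modularSymbol f ((a : ℚ) / c) - modularSymbol f (1 / (q : ℚ)) ∈ periodLattice f := by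
  have hq0 : q ≠ 0 := by rintro rfl; exact hc0 (by rw [hc, zero_mul])
  obtain ⟨u, v, huv⟩ := hac
  obtain ⟨u', v', hu'v'⟩ := hcM
  -- `D ≡ u ≡ a⁻¹ (mod c)`, `D ≡ c' (mod M)`; `B = (aD - 1)/c`
  set D : ℤ := u + c * (u' * (c' - u)) with hD
  set B : ℤ := a * (u' * (c' - u)) - v with hB
  have hB' : a * D - 1 = c * B := by rw [hD, hB]; linear_combination huv
  have hC' : c - q * D = (N : ℤ) * (v' * (c' - u)) := by
    rw [hD]; linear_combination (-(q * (c' - u))) * hu'v' + (-(v' * (c' - u))) * hN + hc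
  let γ : SL(2, ℤ) := ⟨!![a - q * B, B; c - q * D, D], by
    rw [Matrix.det_fin_two_of]; linear_combination hB'⟩
  have hγ0 : γ ∈ Gamma0 N := by
    rw [Gamma0_mem]
    show (((c - q * D : ℤ)) : ZMod N) = 0
    rw [hC']
    push_cast
    rw [ZMod.natCast_self, zero_mul]
  have hqQ : (q : ℚ) ≠ 0 := by exact_mod_cast hq0
  have hcQ : (c : ℚ) ≠ 0 := by exact_mod_cast hc0
  have e00 : (γ 0 0 : ℤ) = a - q * B := rfl
  have e01 : (γ 0 1 : ℤ) = B := rfl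
  have e10 : (γ 1 0 : ℤ) = c - q * D := rfl
  have e11 : (γ 1 1 : ℤ) = D := rfl
  have hden : ((γ 1 0 : ℤ) : ℚ) * (1 / (q : ℚ)) + ((γ 1 1 : ℤ) : ℚ) = (c : ℚ) / q := by
    rw [e10, e11]; push_cast; field_simp; ring
  have hnum : ((γ 0 0 : ℤ) : ℚ) * (1 / (q : ℚ)) + ((γ 0 1 : ℤ) : ℚ) = (a : ℚ) / q := by
    rw [e00, e01]; push_cast; field_simp; ring
  have hne : ((γ 1 0 : ℤ) : ℚ) * (1 / (q : ℚ)) + ((γ 1 1 : ℤ) : ℚ) ≠ 0 := by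
    rw [hden]; exact div_ne_zero hcQ hqQ
  have key := modularSymbol_gamma0_smul_holds f ⟨γ, hγ0⟩ (1 / (q : ℚ)) hne
  have hquot : (((γ 0 0 : ℤ) : ℚ) * (1 / (q : ℚ)) + ((γ 0 1 : ℤ) : ℚ)) /
      (((γ 1 0 : ℤ) : ℚ) * (1 / (q : ℚ)) + ((γ 1 1 : ℤ) : ℚ)) = (a : ℚ) / c := by
    rw [hnum, hden, div_div_div_cancel_right₀ hqQ]
  rw [hquot] at key
  rw [key, add_sub_cancel_right]
  exact cuspSymbol_mem_periodLattice f _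

/-- **The `2 ∥ N` cusp class**: for `N = 2M`, a cusp `a/c` in lowest terms with `c = 2c' ≠ 0` and
`gcd(c, M) = 1` (e.g. `M` odd and `c = 2ᵐ`, `m ≥ 1`) satisfies `{∞, a/c}_f − {∞, 1/2}_f ∈ Λ_f`
(`modularSymbol_div_sub_inv_mem_periodLattice` at `q = 2`). [cite: CremonaAlgorithms1997, §2.2 Lemma 2.2.3] -/
theorem modularSymbol_div_sub_half_mem_periodLattice {M a c c' : ℤ} (hN : (N : ℤ) = 2 * M)
    (hc : c = 2 * c') (hc0 : c ≠ 0) (hac : IsCoprime a c) (hcM : IsCoprime c M) :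
    modularSymbol f ((a : ℚ) / c) - modularSymbol f (1 / 2) ∈ periodLattice f := by
  have h := modularSymbol_div_sub_inv_mem_periodLattice f hN hc hc0 hac hcM
  rwa [Int.cast_ofNat] at h

/-! ### §3. `2·[r]⁻_f ∈ ℤ` -/

/-- **`[r]⁻_f ∈ ½ℤ` (as a real number) when `{∞, r} ≡ {∞, r₀} (mod Λ_f)` with `im {∞, r₀} = 0`**,
for real-coefficient `f`: `im (minusSymbol f r) = im {∞, r}_f = k Ω⁻_f/2` (`im Λ_f = ℤ · Ω⁻_f/2`,
`minusPeriod_eq_zero_or`; in the junk case `Ω⁻_f = 0` the symbol is `0`).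
[cite: MazurTateTeitelbaum1986Invent, §I.8] [cite: CremonaAlgorithms1997, §2.8] -/
theorem exists_normalizedMinusSymbol_eq_div_two (hreal : ∀ n, (cuspCoeff f n).im = 0) {r r₀ : ℚ}
    (h : modularSymbol f r - modularSymbol f r₀ ∈ periodLattice f) (h₀ : (modularSymbol f r₀).im = 0) :
    ∃ k : ℤ, normalizedMinusSymbol f r = (k : ℝ) / 2 := by
  rcases minusPeriod_eq_zero_or f with h0 | ⟨hpos, him⟩
  · exact ⟨0, by rw [normalizedMinusSymbol, h0, div_zero]; simp⟩
  · obtain ⟨k, hk⟩ := exists_im_eq_of_sub_mem f him h h₀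
    refine ⟨k, ?_⟩
    have hM : (minusSymbol f r).im = (modularSymbol f r).im := by
      rw [minusSymbol_eq_im_mul_I_holds f hreal r, Complex.mul_im, Complex.ofReal_re,
        Complex.ofReal_im, Complex.I_re, Complex.I_im]
      ring
    rw [normalizedMinusSymbol, hM, hk]
    field_simp

/-! ### §5a. Oddness of the minus symbol -/

omit [NeZero N] in
/-- `minusSymbol f (−r) = −minusSymbol f r`: the minus symbol `({∞, r} − {∞, −r})/2` is odd by
construction (Mazur–Tate–Teitelbaum 1986, §I.8, "`[−r]⁻ = −[r]⁻`"). [cite: MazurTateTeitelbaum1986Invent, §I.8] -/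
theorem minusSymbol_neg (r : ℚ) : minusSymbol f (-r) = -minusSymbol f r := by
  simp only [minusSymbol, neg_neg]
  ring

omit [NeZero N] in
/-- `normalizedMinusSymbol f (−r) = −normalizedMinusSymbol f r`. [cite: MazurTateTeitelbaum1986Invent, §I.8] -/
theorem normalizedMinusSymbol_neg (r : ℚ) :
    normalizedMinusSymbol f (-r) = -normalizedMinusSymbol f r := by
  rw [normalizedMinusSymbol, normalizedMinusSymbol, minusSymbol_neg, Complex.neg_im, neg_div]

end Symbols

end Literature.NumberTheory.EllipticCurves.ModularForms

namespace Literature.NumberTheory.EllipticCurves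

section RatSymbol

variable {N : ℕ} [NeZero N] (f : CuspForm (Gamma0 N) 2)

/-- **`[r]⁻_f = k/2`, `k ∈ ℤ`, when `{∞, r} ≡ {∞, r₀} (mod Λ_f)` with `im {∞, r₀}_f = 0`** (real
coefficients; the `dite` defining `ratMinusSymbol` fires since `[r]⁻` is then rational).
[cite: MazurTateTeitelbaum1986Invent, §I.8] -/
theorem exists_ratMinusSymbol_eq_div_two_of_sub_mem (hreal : ∀ n, (cuspCoeff f n).im = 0)
    {r r₀ : ℚ} (h : modularSymbol f r - modularSymbol f r₀ ∈ periodLattice f)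
    (h₀ : (modularSymbol f r₀).im = 0) :
    ∃ k : ℤ, ratMinusSymbol f r = (k : ℚ) / 2 := by
  classical
  obtain ⟨k, hk⟩ := exists_normalizedMinusSymbol_eq_div_two f hreal h h₀
  have hex : ∃ q : ℚ, (q : ℝ) = normalizedMinusSymbol f r :=
    ⟨(k : ℚ) / 2, by rw [hk]; push_cast; rfl⟩
  refine ⟨k, ?_⟩
  rw [ratMinusSymbol, dif_pos hex]
  apply Rat.cast_injective (α := ℝ)
  rw [hex.choose_spec, hk]
  push_cast
  rfl

/-- **`2·[r]⁻_f ∈ ℤ` at a cusp with denominator prime to `N`** (any level; real coefficients):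
`{∞, r} ≡ {∞, 0} (mod Λ_f)` (`modularSymbol_sub_zero_mem_periodLattice`) and `im {∞, 0}_f = 0`.
In particular `[a/pⁿ]⁻_f ∈ ½ℤ` for every prime `p ∤ N`. [cite: Manin1972, Prop. 1.4 and Thm. 1.6]
[cite: MazurTateTeitelbaum1986Invent, §I.8] -/
theorem exists_ratMinusSymbol_eq_div_two_of_coprime (hreal : ∀ n, (cuspCoeff f n).im = 0)
    {r : ℚ} (hr : Nat.Coprime r.den N) :
    ∃ k : ℤ, ratMinusSymbol f r = (k : ℚ) / 2 :=
  exists_ratMinusSymbol_eq_div_two_of_sub_mem f hreal (modularSymbol_sub_zero_mem_periodLattice f hr)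
    (im_modularSymbol_zero f hreal)

omit [NeZero N] in
/-- The denominator of `v / qᵏ` divides `qᵏ` (`v q k : ℕ`) (private arithmetic helper). [folklore] -/
private theorem den_natCast_div_pow_dvd (v q k : ℕ) : ((v : ℚ) / (q : ℚ) ^ k).den ∣ q ^ k := by
  have h := Rat.den_dvd (v : ℤ) ((q : ℤ) ^ k)
  rw [Rat.divInt_eq_div] at h
  push_cast at h
  exact_mod_cast h

omit [NeZero N] in
/-- The denominator of `a / 2ⁿ` divides `2ⁿ` (`a : ℤ`) (private arithmetic helper). [folklore] -/
private theorem den_intCast_div_two_pow_dvd (a : ℤ) (n : ℕ) : ((a : ℚ) / 2 ^ n).den ∣ 2 ^ n := by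
  have h := Rat.den_dvd a ((2 : ℤ) ^ n)
  rw [Rat.divInt_eq_div] at h
  push_cast at h
  exact_mod_cast h

/-- **`2·[r]⁻_f ∈ ℤ` at every cusp of `2`-power denominator, for `4 ∤ N`** (real coefficients):
if `den r = 2ᵐ` then either `gcd(2ᵐ, N) = 1` (`m = 0` or `N` odd: `…_of_coprime`), or `m ≥ 1` and
`N = 2M` with `M` odd, and then `{∞, r} ≡ {∞, 1/2} (mod Λ_f)`
(`modularSymbol_div_sub_half_mem_periodLattice`) with `im {∞, 1/2}_f = 0`. The o1 lens-1 statement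
"S1 `two_mul_ratMinusSymbol_mem_int`". [cite: CremonaAlgorithms1997, §2.2 Lemma 2.2.3]
[cite: MazurTateTeitelbaum1986Invent, §I.8] -/
theorem exists_ratMinusSymbol_eq_div_two (hreal : ∀ n, (cuspCoeff f n).im = 0) (h4 : ¬ 4 ∣ N)
    {r : ℚ} {n : ℕ} (hr : r.den ∣ 2 ^ n) :
    ∃ k : ℤ, ratMinusSymbol f r = (k : ℚ) / 2 := by
  obtain ⟨m, -, hm⟩ := (Nat.dvd_prime_pow Nat.prime_two).mp hr
  by_cases hcop : Nat.Coprime r.den N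
  · exact exists_ratMinusSymbol_eq_div_two_of_coprime f hreal hcop
  -- not coprime: `m ≥ 1` and `2 ∣ N`, so `N = 2M` with `M` odd
  have hm0 : m ≠ 0 := by
    rintro rfl
    rw [hm, pow_zero] at hcop
    exact hcop (Nat.gcd_one_left N)
  obtain ⟨m', rfl⟩ : ∃ m', m = m' + 1 := ⟨m - 1, by omega⟩
  have h2N : 2 ∣ N := by
    by_contra h2N
    rw [hm] at hcop
    exact hcop (((Nat.Prime.coprime_iff_not_dvd Nat.prime_two).mpr h2N).pow_left _)
  obtain ⟨M, hM⟩ := h2N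
  have hModd : ¬ 2 ∣ M := fun ⟨t, ht⟩ ↦ h4 ⟨t, by rw [hM, ht]; ring⟩
  have hN : (N : ℤ) = 2 * (M : ℤ) := by exact_mod_cast hM
  have hden : ((r.den : ℕ) : ℤ) = 2 * (2 : ℤ) ^ m' := by rw [hm]; push_cast; ring
  have hden0 : ((r.den : ℕ) : ℤ) ≠ 0 := by exact_mod_cast r.den_ne_zero
  have hac : IsCoprime r.num ((r.den : ℕ) : ℤ) := by
    rw [Int.isCoprime_iff_gcd_eq_one, Int.gcd, Int.natAbs_natCast]
    exact r.reduced
  have h2M : IsCoprime (2 : ℤ) (M : ℤ) :=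
    Nat.isCoprime_iff_coprime.mpr ((Nat.Prime.coprime_iff_not_dvd Nat.prime_two).mpr hModd)
  have hcM : IsCoprime ((r.den : ℕ) : ℤ) (M : ℤ) := by
    rw [hden, ← pow_succ']
    exact h2M.pow_left
  have h := modularSymbol_div_sub_half_mem_periodLattice f hN hden hden0 hac hcM
  have hr' : ((r.num : ℤ) : ℚ) / (((r.den : ℕ) : ℤ) : ℚ) = r := by
    push_cast
    exact Rat.num_div_den r
  rw [hr'] at h
  exact exists_ratMinusSymbol_eq_div_two_of_sub_mem f hreal h (im_modularSymbol_half f hreal)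

/-- **`2·[a/2ⁿ]⁻_f ∈ ℤ` for `4 ∤ N`** — the o1 lens-1 S1 statement `two_mul_ratMinusSymbol_mem_int`
verbatim (`a : ℤ`, `n : ℕ`; real coefficients). [cite: MazurTateTeitelbaum1986Invent, §I.8] -/
theorem exists_two_mul_ratMinusSymbol_eq_intCast (hreal : ∀ n, (cuspCoeff f n).im = 0)
    (h4 : ¬ 4 ∣ N) (a : ℤ) (n : ℕ) :
    ∃ z : ℤ, 2 * ratMinusSymbol f ((a : ℚ) / 2 ^ n) = z := by
  obtain ⟨k, hk⟩ := exists_ratMinusSymbol_eq_div_two f hreal h4 (den_intCast_div_two_pow_dvd a n)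
  exact ⟨k, by rw [hk]; ring⟩

/-! ### §4. Norm bounds: `‖[r]⁻‖₂ ≤ 2`, `‖[r]⁻‖_p ≤ 1` (`p` odd), and the minus measure -/

/-- **`‖[r]⁻_f‖₂ ≤ 2`** at cusps of `2`-power denominator, `4 ∤ N`: `‖k/2‖₂ = 2‖k‖₂ ≤ 2`.
[cite: MazurTateTeitelbaum1986Invent, §I.8] -/
theorem norm_ratMinusSymbol_two_le_two (hreal : ∀ n, (cuspCoeff f n).im = 0) (h4 : ¬ 4 ∣ N)
    {r : ℚ} {n : ℕ} (hr : r.den ∣ 2 ^ n) :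
    ‖((ratMinusSymbol f r : ℚ) : ℚ_[2])‖ ≤ 2 := by
  obtain ⟨k, hk⟩ := exists_ratMinusSymbol_eq_div_two f hreal h4 hr
  have h2 : ‖(2 : ℚ_[2])‖ = (2 : ℝ)⁻¹ := by
    have h := Padic.norm_p (p := 2)
    simpa using h
  rw [hk]
  push_cast
  rw [norm_div, h2, div_inv_eq_mul]
  calc ‖((k : ℤ) : ℚ_[2])‖ * 2 ≤ 1 * 2 := by gcongr; exact Padic.norm_int_le_one k
    _ = 2 := one_mul _

/-- **`‖[r]⁻_f‖_p ≤ 1` for ODD `p` at cusps with denominator prime to `N`** (e.g. `r = a/pᵐ`,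
`p ∤ N`): `[r]⁻ = k/2` and `‖2‖_p = 1`. The minus twin of `norm_ratPlusSymbol_le_one`, WITHOUT
Eisenstein hypothesis. [cite: MazurTateTeitelbaum1986Invent, §I.8] -/
theorem norm_ratMinusSymbol_le_one {p : ℕ} [Fact p.Prime] (hp2 : p ≠ 2)
    (hreal : ∀ n, (cuspCoeff f n).im = 0) {r : ℚ} (hr : Nat.Coprime r.den N) :
    ‖((ratMinusSymbol f r : ℚ) : ℚ_[p])‖ ≤ 1 := by
  have hp : p.Prime := Fact.out
  obtain ⟨k, hk⟩ := exists_ratMinusSymbol_eq_div_two_of_coprime f hreal hr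
  have h2 : ‖((2 : ℤ) : ℚ_[p])‖ = 1 := by
    refine le_antisymm (Padic.norm_int_le_one _) (not_lt.mp fun hlt ↦ ?_)
    have hdvd : (p : ℤ) ∣ 2 := Padic.norm_intCast_lt_one_iff.mp hlt
    have hp2' : p ∣ 2 := by exact_mod_cast hdvd
    exact hp2 ((Nat.prime_dvd_prime_iff_eq hp Nat.prime_two).mp hp2')
  rw [hk]
  push_cast
  rw [norm_div, show ((2 : ℚ_[p])) = ((2 : ℤ) : ℚ_[p]) by norm_cast, h2, div_one]
  exact Padic.norm_int_le_one k

/-! ### §5b. Oddness of `[·]⁻` and of the minus measure -/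

omit [NeZero N] in
/-- **`[−r]⁻_f = −[r]⁻_f`**: the rational minus symbol is odd (it depends on `r` only through
`normalizedMinusSymbol f r`, in both branches of its `dite`; Mazur–Tate–Teitelbaum 1986, §I.8).
Twin of `ratPlusSymbol_neg`. [cite: MazurTateTeitelbaum1986Invent, §I.8] -/
theorem ratMinusSymbol_neg (r : ℚ) : ratMinusSymbol f (-r) = -ratMinusSymbol f r := by
  classical
  by_cases hex : ∃ q : ℚ, (q : ℝ) = normalizedMinusSymbol f r
  · have hex' : ∃ q : ℚ, (q : ℝ) = normalizedMinusSymbol f (-r) := by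
      obtain ⟨q, hq⟩ := hex
      exact ⟨-q, by rw [normalizedMinusSymbol_neg, ← hq]; push_cast; rfl⟩
    unfold ratMinusSymbol
    rw [dif_pos hex', dif_pos hex]
    apply Rat.cast_injective (α := ℝ)
    push_cast
    rw [hex'.choose_spec, hex.choose_spec, normalizedMinusSymbol_neg]
  · have hex' : ¬ ∃ q : ℚ, (q : ℝ) = normalizedMinusSymbol f (-r) := by
      rintro ⟨q, hq⟩
      rw [normalizedMinusSymbol_neg] at hq
      exact hex ⟨-q, by push_cast; linarith⟩
    unfold ratMinusSymbol
    rw [dif_neg hex', dif_neg hex, neg_zero]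

end RatSymbol

section Measure

variable {N : ℕ} [NeZero N] (f : CuspForm (Gamma0 N) 2)

/-- **`‖μ⁻_{f,α}(a + 2ᵐℤ₂)‖ ≤ 2` for `4 ∤ N` and `‖α⁻¹‖ ≤ 1`** (real coefficients):
`μ⁻(a + 2^{m+1}ℤ₂) = α^{−(m+1)}[a/2^{m+1}]⁻ − α^{−(m+2)}[a/2ᵐ]⁻` with both symbols of norm `≤ 2`
(`norm_ratMinusSymbol_two_le_two`) and `ℚ₂` non-archimedean; `μ⁻(ℤ₂) = 0`.
[cite: MazurTateTeitelbaum1986Invent, §I.10 (10.1)] -/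
theorem norm_msdMinusMeasure_two_le_two (hreal : ∀ n, (cuspCoeff f n).im = 0) (h4 : ¬ 4 ∣ N)
    {α : ℚ_[2]} (hα : ‖α⁻¹‖ ≤ 1) :
    ∀ (m : ℕ) (a : ZMod (2 ^ m)), ‖msdMinusMeasure f α m a‖ ≤ 2
  | 0, a => by rw [msdMinusMeasure_zero, norm_zero]; norm_num
  | m + 1, a => by
    have hb : ∀ i j : ℕ,
        ‖α⁻¹ ^ j * ((ratMinusSymbol f (((a.val : ℕ) : ℚ) / ((2 : ℕ) : ℚ) ^ i) : ℚ) : ℚ_[2])‖ ≤ 2 := by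
      intro i j
      rw [norm_mul, norm_pow]
      have h1 : ‖α⁻¹‖ ^ j ≤ 1 := pow_le_one₀ (norm_nonneg _) hα
      have h2 := norm_ratMinusSymbol_two_le_two f hreal h4 (den_natCast_div_pow_dvd a.val 2 i)
      calc _ ≤ 1 * 2 := mul_le_mul h1 h2 (norm_nonneg _) zero_le_one
        _ = 2 := one_mul _
    show ‖α⁻¹ ^ (m + 1) * _ - α⁻¹ ^ (m + 2) * _‖ ≤ 2
    rw [sub_eq_add_neg]
    refine (Padic.nonarchimedean _ _).trans (max_le (hb _ _) ?_)
    rw [norm_neg]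
    exact hb _ _

/-- **`‖μ⁻_{f,α}(a + pᵐℤ_p)‖ ≤ 1` for an ODD prime `p ∤ N` and `‖α⁻¹‖ ≤ 1`** (real coefficients):
the cusps `a/pᵏ` have denominator prime to `N`, so `‖[a/pᵏ]⁻‖_p ≤ 1` (`norm_ratMinusSymbol_le_one`).
The boundedness of the minus measure at good odd `p`, with NO Eisenstein / irreducibility hypothesis
(contrast `norm_msdMeasure_le_one`). [cite: MazurTateTeitelbaum1986Invent, §I.10 (10.1)] -/
theorem norm_msdMinusMeasure_le_one {p : ℕ} [Fact p.Prime] (hp2 : p ≠ 2) (hpN : ¬ p ∣ N)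
    (hreal : ∀ n, (cuspCoeff f n).im = 0) {α : ℚ_[p]} (hα : ‖α⁻¹‖ ≤ 1) :
    ∀ (m : ℕ) (a : ZMod (p ^ m)), ‖msdMinusMeasure f α m a‖ ≤ 1
  | 0, a => by rw [msdMinusMeasure_zero, norm_zero]; norm_num
  | m + 1, a => by
    have hp : p.Prime := Fact.out
    have hcop : ∀ i : ℕ, Nat.Coprime (((a.val : ℕ) : ℚ) / (p : ℚ) ^ i).den N := fun i ↦
      Nat.Coprime.coprime_dvd_left (den_natCast_div_pow_dvd a.val p i)
        (((Nat.Prime.coprime_iff_not_dvd hp).mpr hpN).pow_left i)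
    have hb : ∀ i j : ℕ,
        ‖α⁻¹ ^ j * ((ratMinusSymbol f (((a.val : ℕ) : ℚ) / (p : ℚ) ^ i) : ℚ) : ℚ_[p])‖ ≤ 1 := by
      intro i j
      rw [norm_mul, norm_pow]
      have h1 : ‖α⁻¹‖ ^ j ≤ 1 := pow_le_one₀ (norm_nonneg _) hα
      have h2 := norm_ratMinusSymbol_le_one f hp2 hreal (hcop i)
      calc _ ≤ 1 * 1 := mul_le_mul h1 h2 (norm_nonneg _) zero_le_one
        _ = 1 := one_mul _
    show ‖α⁻¹ ^ (m + 1) * _ - α⁻¹ ^ (m + 2) * _‖ ≤ 1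
    rw [sub_eq_add_neg]
    refine (Padic.nonarchimedean _ _).trans (max_le (hb _ _) ?_)
    rw [norm_neg]
    exact hb _ _

/-- **The minus measure is odd**: `μ⁻_{f,α}(−a + pᵐℤ_p) = −μ⁻_{f,α}(a + pᵐℤ_p)` (any prime `p`, any
level). For `m = 0` both sides vanish (`msdMinusMeasure_zero`); for `m + 1` and `a ≠ 0` the
representative of `−a` is `p^{m+1} − a.val`, and `[(p^{m+1} − v)/p^{m+1}]⁻ = [−v/p^{m+1} + 1]⁻ =
−[v/p^{m+1}]⁻`, `[(p^{m+1} − v)/pᵐ]⁻ = [−v/pᵐ + p]⁻ = −[v/pᵐ]⁻` by translation invariance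
(`ratMinusSymbol_add_intCast`) and oddness (`ratMinusSymbol_neg`). Twin of `msdMeasure_neg`.
[cite: MazurTateTeitelbaum1986Invent, §I.10 (10.1) and §I.4 (4.2)] -/
theorem msdMinusMeasure_neg {p : ℕ} [Fact p.Prime] (α : ℚ_[p]) : ∀ (m : ℕ) (a : ZMod (p ^ m)),
    msdMinusMeasure f α m (-a) = -msdMinusMeasure f α m a
  | 0, a => by rw [msdMinusMeasure_zero, msdMinusMeasure_zero, neg_zero]
  | m + 1, a => by
    have hp : p.Prime := Fact.out
    haveI : NeZero (p ^ (m + 1)) := ⟨pow_ne_zero _ hp.ne_zero⟩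
    by_cases ha : a = 0
    · subst ha
      have h0 : msdMinusMeasure f α (m + 1) 0 = 0 := by
        simp only [msdMinusMeasure, ZMod.val_zero, Nat.cast_zero, zero_div, ratMinusSymbol_zero,
          Rat.cast_zero, mul_zero, sub_zero]
      rw [neg_zero, h0, neg_zero]
    have hval : (-a).val = p ^ (m + 1) - a.val := by rw [ZMod.neg_val, if_neg ha]
    have hlt : a.val ≤ p ^ (m + 1) := (ZMod.val_lt a).le
    have hcast : (((-a).val : ℕ) : ℚ) = (p : ℚ) ^ (m + 1) - (a.val : ℚ) := by
      rw [hval, Nat.cast_sub hlt]; push_cast; ring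
    have hp0 : (p : ℚ) ≠ 0 := by exact_mod_cast hp.ne_zero
    have h1 : ratMinusSymbol f ((((-a).val : ℕ) : ℚ) / (p : ℚ) ^ (m + 1)) =
        -ratMinusSymbol f (((a.val : ℕ) : ℚ) / (p : ℚ) ^ (m + 1)) := by
      have e : (((-a).val : ℕ) : ℚ) / (p : ℚ) ^ (m + 1) =
          -(((a.val : ℕ) : ℚ) / (p : ℚ) ^ (m + 1)) + ((1 : ℤ) : ℚ) := by
        rw [hcast]; push_cast; field_simp; ring
      rw [e, ratMinusSymbol_add_intCast, ratMinusSymbol_neg]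
    have h2 : ratMinusSymbol f ((((-a).val : ℕ) : ℚ) / (p : ℚ) ^ m) =
        -ratMinusSymbol f (((a.val : ℕ) : ℚ) / (p : ℚ) ^ m) := by
      have e : (((-a).val : ℕ) : ℚ) / (p : ℚ) ^ m =
          -(((a.val : ℕ) : ℚ) / (p : ℚ) ^ m) + ((p : ℤ) : ℚ) := by
        rw [hcast]; push_cast; field_simp; ring
      rw [e, ratMinusSymbol_add_intCast, ratMinusSymbol_neg]
    simp only [msdMinusMeasure, h1, h2]
    push_cast
    ring

end Measure

end Literature.NumberTheory.EllipticCurves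

end
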